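/-
COR-CM (cells pub-hodgecm / pub-hodgecm2, stage 2 of the Hodge ladder) — Δ2 BRIDGE, COORDINATOR «Δ2 RESTRUCTURE FOR SPEED» 2026-08-23,
sublemma S1 (seat d2bridge-prove-1): NAMED FIELD VALUES of the S1 record.  The S1 core `exists_liuCMRecord_of_cmDatum`
(`CorCM/D2Bridge/HcmS1LiuCMRecord.lean`) is an `∃`; the pin wrapper `dLiu q : LiuCMSide` (port-gated) and the S4 pin field
`f_of φ : P_Γ ⟶ (dLiu q).A.X` (seat d2bridge-prove-4) must refer to THE SAME witnesses.  This file NAMES them once (`Exists.choose`),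
hole-free, so that every pin file elaborates against tree constants: `liuModel` (= `(dLiu q).A`), `liuModelIso` (the isogeny
`u : A_μ ⊗ ℂ ⟶ liuModel`, through which S4 factors `f_of φ := f_φ ≫ u`), `liuModelRing ∕ liuModelAction` (= `ιA ∕ θA`), `liuModelClass`
(= `(dLiu 1).α`), with their specification theorems.  DEFINITIONS (5 `def`s by `Exists.choose`, no instance, no structure) + theorems;
no named fact, no `sorry`; nothing landed is edited or restated.  FRAMING: HC_CM is NOT proved; «Δ2 BRIDGE CLOSED» is NOT claimed.
-/
import Summits.HodgeConjecture.CorCM.D2Bridge.HcmS1LiuCMRecord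
import Literature.NumberTheory.Automorphic.Liu2021.AppendixC.RestOne
import HarnessLib

set_option autoImplicit false

/-!
# Δ2 bridge, S1: the witnesses of `exists_liuCMRecord_of_cmDatum`, NAMED

For `L/ℚ` Galois CM, the pin `ι₁`, a conjugate-symplectic weight-one `μ`, ONE object `X : Def45.CMDatum (AlgHom.id ℚ L) ι₁ hμ hw Car` of
[Liu2021] Def. 4.5 (2) AS PRINTED and Liu's eigenclass `(α₀, hα₀, hα₀0)` (proof of Thm. 4.18, l. 2250; supplied by
`exists_liu_eigenclass`, `CorCM/D2Bridge/HcmS1LiuEigenclass.lean`, or by the pin record `M.α`):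
* `liuModel` — the principal model `B` of `A_μ ⊗_{L,ι₁} ℂ` (the record's `A`);
* `liuModelIso` — the isogeny `u : A_μ ⊗_{L,ι₁} ℂ ⟶ liuModel` (`liuModelIso_isIsogeny`);
* `liuModelRing : 𝓞_{M_μ} → End liuModel`, `liuModelAction : M_μ → End_ℂ H¹(liuModel(ℂ); ℂ)` (the record's `ιA`, `θA`) with
  `liuModel_isCMTypeRealisation : IsCMTypeRealisation Ψ̃_μ liuModel liuModelRing liuModelAction`, `Ψ̃_μ` THE INFLATED REFLEX TYPE
  `inducedCMType (Def45.incl id ι₁ hμ) (reflexCMType ι₁ Φ_μ id)` (the record's `ΦA`, `isRealisation`);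
* `liuModelClass ∈ ℂ ⊗ H¹(liuModel(ℂ); ℚ)` (the record's `α` at `q = 1`) with `liuModelClass_mem_eigenline` (the record's `α_mem`, verbatim
  currency), `liuModelClass_ne_zero`, and **`baseChange_pull_comp_liuModelIso`**: `(f ≫ u)^* liuModelClass = f^* α₀` for every
  `ℂ`-morphism `f : Y ⟶ A_μ ⊗ ℂ` — the law behind S4's `geom_eq` (`f_of φ := f_φ ≫ liuModelIso`).
All are projections of the one `∃` of the S1 core; nothing new is proved about Liu's objects.  HC_CM is NOT proved.

References: Y. Liu, arXiv:2102.11518 = Camb. J. Math. 9 (2021), Def. 4.5 (2) (`FJcycle.tex` l. 1944–1951), proof of Thm. 4.18 l. 2246–2253;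
G. Shimura, *Abelian Varieties with Complex Multiplication and Modular Functions* (1998) §7.1 Prop. 7.
-/

noncomputable section

open scoped TensorProduct

namespace Summit.HodgeConjecture.CorCM.D2Bridge

open CategoryTheory NumberField
open Literature.AlgebraicGeometry.Motives Literature.AlgebraicGeometry.HodgeTheory
open Literature.AlgebraicGeometry.ComplexMultiplication
open Literature.NumberTheory.ComplexMultiplication Literature.NumberTheory.Automorphic
open Literature.NumberTheory.Automorphic.IdeleClassGroup Literature.NumberTheory.Automorphic.PicardCM
open Literature.NumberTheory.Automorphic.Liu2021

section Named

variable {L : Type} [Field L] [NumberField L] [IsCMField L] [IsGalois ℚ L] (ι₁ : L →+* ℂ)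
  {μ : IdeleClassGroup L →ₜ* Circle} {hμ : IsConjugateSymplectic L μ} {hw : HasWeight L μ 1} {Car : Def45.Carriers L μ}
  (X : Def45.CMDatum (AlgHom.id ℚ L) ι₁ hμ hw Car)
  (α₀ : ℂ ⊗[ℚ] bettiCohomology (letI := ι₁.toAlgebra; (X.A.baseChange ℂ).X) 1)
  (hα₀ : letI := ι₁.toAlgebra; haveI := hμ.numberField_muAlgValueField
    ∀ k : muAlgValueField L μ,
      (hOneAlgHom ((AbelianVariety.endAlgebra.mapRingHom (X.A.endBaseChange ℂ)).toRingHom.comp X.i) k).baseChange ℂ α₀ =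
        ((k : muAlgValueField L μ) : ℂ) • α₀)
  (hα₀0 : α₀ ≠ 0)

/-- **`B` — the principal model of `A_μ ⊗_{L,ι₁} ℂ`** carrying Liu's datum as a model CM record (the record's `A`).
[cite: Shimura1998, §7.1 Proposition 7 (p. 47)] [cite: Liu2021, Def. 4.5 (2) (FJcycle.tex l. 1944–1951)] -/
def liuModel : AbelianVariety ℂ :=
  (exists_liuCMRecord_of_cmDatum ι₁ X α₀ hα₀ hα₀0).choose

/-- **`u : A_μ ⊗_{L,ι₁} ℂ ⟶ B`**, the isogeny onto the principal model (S4 factors its `f_of φ` through it).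
[cite: Shimura1998, §7.1 Proposition 7 (p. 47)] -/
def liuModelIso : (letI := ι₁.toAlgebra; X.A.baseChange ℂ) ⟶ liuModel ι₁ X α₀ hα₀ hα₀0 :=
  (exists_liuCMRecord_of_cmDatum ι₁ X α₀ hα₀ hα₀0).choose_spec.choose

/-- **`ιB : 𝓞_{M_μ} → End B`** — the INTEGRAL multiplication of the principal model (the record's `ιA`).
[cite: Shimura1998, §7.1 Proposition 7 (p. 47)] -/
def liuModelRing : letI := hμ.numberField_muAlgValueField; 𝓞 (muAlgValueField L μ) →+* End (liuModel ι₁ X α₀ hα₀ hα₀0) :=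
  (exists_liuCMRecord_of_cmDatum ι₁ X α₀ hα₀ hα₀0).choose_spec.choose_spec.choose

/-- **`θB : M_μ → End_ℂ H¹(B(ℂ); ℂ)`** — its action on `H¹` (the record's `θA`). [cite: Shimura1998, §5.2 (pp. 36–37)] -/
def liuModelAction : muAlgValueField L μ →+* Module.End ℂ (complexBetti (liuModel ι₁ X α₀ hα₀ hα₀0).X 1) :=
  (exists_liuCMRecord_of_cmDatum ι₁ X α₀ hα₀ hα₀0).choose_spec.choose_spec.choose_spec.choose

/-- **`(B, ιB, θB)` realises THE INFLATED REFLEX TYPE `Ψ̃_μ = inducedCMType e_μ (reflexCMType ι₁ Φ_μ id)` on `H¹`** (the record's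
`isRealisation`; [Liu2021] Def. 4.5 (2) ⇒ CM type of `A_μ` = the inflation of `Ψ_μ` along `M'_μ ⊆ M_μ`).
[cite: Liu2021, Def. 4.5 (2) (FJcycle.tex l. 1944–1951), Def. 4.3 (2) (l. 1919), §4.1 l. 1928] [cite: Shimura1998, §5.2 (pp. 36–37) and §7.1 Proposition 7 (p. 47)] -/
theorem liuModel_isCMTypeRealisation :
    letI := hμ.numberField_muAlgValueField
    IsCMTypeRealisation (inducedCMType (Def45.incl (AlgHom.id ℚ L) ι₁ hμ) (reflexCMType ι₁ hμ.cmType (AlgHom.id ℚ L)))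
      (liuModel ι₁ X α₀ hα₀ hα₀0) (liuModelRing ι₁ X α₀ hα₀ hα₀0) (liuModelAction ι₁ X α₀ hα₀ hα₀0) :=
  (exists_liuCMRecord_of_cmDatum ι₁ X α₀ hα₀ hα₀0).choose_spec.choose_spec.choose_spec.choose_spec.choose

/-- **`α' ∈ ℂ ⊗ H¹(B(ℂ); ℚ)`** — Liu's eigenclass transported to the principal model (the record's `α` at `q = 1`; `(dLiu q).α = q • α'`).
[cite: Liu2021, proof of Thm. 4.18 (FJcycle.tex l. 2250)] [cite: MumfordAV1970, §19 Remark p. 169] -/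
def liuModelClass : ℂ ⊗[ℚ] bettiCohomology (liuModel ι₁ X α₀ hα₀ hα₀0).X 1 :=
  (exists_liuCMRecord_of_cmDatum ι₁ X α₀ hα₀ hα₀0).choose_spec.choose_spec.choose_spec.choose_spec.choose_spec.choose

/-- `u` is an isogeny. [cite: Shimura1998, §7.1 Proposition 7 (p. 47)] -/
theorem liuModelIso_isIsogeny : AbelianVariety.IsIsogeny (liuModelIso ι₁ X α₀ hα₀ hα₀0) :=
  (exists_liuCMRecord_of_cmDatum ι₁ X α₀ hα₀ hα₀0).choose_spec.choose_spec.choose_spec.choose_spec.choose_spec.choose_spec.1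

/-- **`α_mem` of the record, verbatim currency**: `α'` is an eigenclass, for `M_μ ⊆ ℂ`, of the complexified rational CM action
`complexify (cmAction θB _)`. [cite: Liu2021, proof of Thm. 4.18 (FJcycle.tex l. 2250)] -/
theorem liuModelClass_mem_eigenline :
    haveI := hμ.numberField_muAlgValueField
    liuModelClass ι₁ X α₀ hα₀ hα₀0 ∈
      eigenline (HodgeCM.CM.CommonReflex.complexify (BettiUniverse.cmAction (liuModelAction ι₁ X α₀ hα₀ hα₀0)
        (liuModel_isCMTypeRealisation ι₁ X α₀ hα₀ hα₀0).isInducedOnIntegers)) (muAlgValueField L μ).subtype :=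
  (exists_liuCMRecord_of_cmDatum ι₁ X α₀ hα₀ hα₀0).choose_spec.choose_spec.choose_spec.choose_spec.choose_spec.choose_spec.2.1

/-- `α' ≠ 0`. [cite: Liu2021, proof of Thm. 4.18 (FJcycle.tex l. 2250)] -/
theorem liuModelClass_ne_zero : liuModelClass ι₁ X α₀ hα₀ hα₀0 ≠ 0 :=
  (exists_liuCMRecord_of_cmDatum ι₁ X α₀ hα₀ hα₀0).choose_spec.choose_spec.choose_spec.choose_spec.choose_spec.choose_spec.2.2.1

/-- **The S4 law, named**: `(f ≫ u)^* α' = f^* α₀` for every `ℂ`-morphism `f : Y ⟶ A_μ ⊗_{L,ι₁} ℂ` — hence, for the pin's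
`f_of φ := f_φ ≫ liuModelIso`, `geom (dLiu q) (f_of φ) = q • f_φ^* α₀`. [cite: MumfordAV1970, §19 Remark p. 169] -/
theorem baseChange_pull_comp_liuModelIso :
    letI := ι₁.toAlgebra
    ∀ (Y : SchemeOver ℂ) (f : Y ⟶ (X.A.baseChange ℂ).X),
      (BettiUniverse.pull (f ≫ (liuModelIso ι₁ X α₀ hα₀ hα₀0).hom.hom.hom) 1).baseChange ℂ (liuModelClass ι₁ X α₀ hα₀ hα₀0) =
        (BettiUniverse.pull f 1).baseChange ℂ α₀ :=
  (exists_liuCMRecord_of_cmDatum ι₁ X α₀ hα₀ hα₀0).choose_spec.choose_spec.choose_spec.choose_spec.choose_spec.choose_spec.2.2.2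

/-- The scaled form used at the pin (`(dLiu q).α = q • α'`): `(f ≫ u)^* (q • α') = q • f^* α₀`. [cite: MumfordAV1970, §19 Remark p. 169] -/
theorem baseChange_pull_comp_liuModelIso_smul (q : ℚ) :
    letI := ι₁.toAlgebra
    ∀ (Y : SchemeOver ℂ) (f : Y ⟶ (X.A.baseChange ℂ).X),
      (BettiUniverse.pull (f ≫ (liuModelIso ι₁ X α₀ hα₀ hα₀0).hom.hom.hom) 1).baseChange ℂ
          ((q : ℂ) • liuModelClass ι₁ X α₀ hα₀ hα₀0) =
        (q : ℂ) • (BettiUniverse.pull f 1).baseChange ℂ α₀ := by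
  intro Y f
  rw [map_smul, baseChange_pull_comp_liuModelIso ι₁ X α₀ hα₀ hα₀0 Y f]

end Named


/-! ## Currency adapter: the pin record's `α_mem` (over `fieldOfValues`, `hOneRingHom`) ⇒ the S1 input `hα₀` -/

/-- **One `α₀` for `M.α` and `dLiu`.**  If Liu's class `α` satisfies the eigen-law in the currency of the pin record `M`
(`Map43RationalData.α_mem` for the `M_μ = fieldOfValues E μ`-module structure through `i_μ ∘ ofFieldOfValues`, e.g. seat prove-2's
`HcmMLine.exists_eigenvector'`), then it satisfies the S1 input `hα₀` (over the tree's `muAlgValueField E μ`, `hOneAlgHom i_{μ,ℂ}`):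
the two value fields have the same elements (`mem_fieldOfValues_iff`) and both actions unfold to `(i_{μ,ℂ} k)^*` (`hOneAlgHom_apply`,
`hOneRingHom_apply`).  So the pin feeds THE SAME class to `M` and to `dLiu`, as S4's `geom_eq` requires. [cite: Liu2021, §4.1 (FJcycle.tex l. 1926–1928) and proof of Thm. 4.18 (l. 2250)] -/
theorem baseChange_hOneAlgHom_of_fieldOfValues {E : Type} [Field E] [NumberField E] [IsCMField E] {μ : IdeleClassGroup E →ₜ* Circle}
    (hμ : IsConjugateSymplectic E μ) {A : AbelianVariety ℂ} (φ : muAlgValueField E μ →+* A.endAlgebra)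
    (α : ℂ ⊗[ℚ] bettiCohomology A.X 1)
    (h : ∀ s : fieldOfValues E μ,
      (hOneRingHom (φ.comp (AppendixC.RestOne.ofFieldOfValues E μ)) s).baseChange ℂ α = ((s : fieldOfValues E μ) : ℂ) • α)
    (k : muAlgValueField E μ) :
    haveI := hμ.numberField_muAlgValueField
    (hOneAlgHom φ k).baseChange ℂ α = ((k : muAlgValueField E μ) : ℂ) • α := by
  haveI := hμ.numberField_muAlgValueField
  let s : fieldOfValues E μ := ⟨(k : ℂ), (mem_fieldOfValues_iff E μ (k : ℂ)).2 k.2⟩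
  have hs : AppendixC.RestOne.ofFieldOfValues E μ s = k := Subtype.ext rfl
  have hk : hOneAlgHom φ k = hOneRingHom (φ.comp (AppendixC.RestOne.ofFieldOfValues E μ)) s := by
    rw [hOneAlgHom_apply, hOneRingHom_apply, RingHom.comp_apply, hs]
  rw [hk, h s]

end Summit.HodgeConjecture.CorCM.D2Bridge

end
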